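import Mathlib

/-!
# Route BarrierLever — item `PrincipalMinorLayoutsNonsingular` (stmt-ValiantsHypothesis-19126):
# the CAPACITY BOUND for principal-minor layout matrices (singleton rows against a column block)

Helper file (`--supports stmt-ValiantsHypothesis-19126`; cell valiant-natproofs, rung V4, 𝒟-side;
prover seat val-np-p3 gen 4). Definition-free, OUTSIDE the theses cone (pure linear algebra over `ℂ`).
The companion file `BarrierLeverPrincipalMinorLayoutsNonsingularRefutation` instantiates it at
`h = 31` and REFUTES item 19126 (TNS).

**The capacity bound** (`tns_det_eq_zero_of_singleton_rows`). Let `K ∈ ℂ^{(h+h)×(h+h)}`,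
`T ⊆ Fin h`, and let `(u_i)_{i<r}`, `(w_j)_{j<r}` be a layout all of whose rows `u_i` are EMPTY OR
SINGLETONS and all of whose columns satisfy `w_j ⊆ T`. If `r > |T|² + 1` then the principal-minor
layout matrix `M = (det K[u_i ⊔ w̄_j])_{i,j}` (x-indices via `Fin.castAddEmb`, y-indices via
`Fin.natAddEmb`, as in item 19126) is SINGULAR — for EVERY `K`. Proof: the principal minor on
`{a} ⊔ w̄` is a BORDERED determinant of `K[w̄]` (`pm_insert`, via `Finset.subtypeInsertEquivOption`),
and a bordered determinant is affine-bilinear in its border (`det_border`, multilinearity of `det`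
in the last row and the last column):
`det K[{a} ⊔ w̄_j] = K_{aa}·det K[w̄_j] + Σ_{c,c' ∈ T} K_{a,c̄}·K_{c̄',a}·E^j_{c,c'}`,
where `E^j_{c,c'}` (a bordered determinant of `K[w̄_j]` with indicator borders) depends only on the
block `K[T̄, T̄]`; so every row of `M` lies in the span of the `1 + |T|²` vectors
`(det K[w̄_j])_j, (E^j_{c,c'})_j`, and `r` linearly independent rows (`det M ≠ 0`,
`Matrix.linearIndependent_rows_iff_isUnit`) would force `r ≤ 1 + |T|²`
(`linearIndependent_iff_card_eq_finrank_span`, `finrank_range_le_card`).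

The same count with rows of size `≤ m` (capacity `≤ Σ_{l ≤ m} C(|T|, l)²`) shows that the universal
witness `det(1 + diag(x,y)·K)` of item 19133 cannot serve layouts of size up to `2^{h/110}`
(rows of size `≤ |T|/10`, columns all subsets of `T`, `|T| = h/110`); only the case `m = 1` is
formalised here.

WHAT THIS IS NOT: nothing about item 19717 `PartitionMinorsHitByVP` itself (whose witness may depend
on the layout; these layouts have other witnesses), nothing on crux stmt-14610 or `VP` vs `VNP`.
-/

set_option linter.dupNamespace false

open Matrix Finset

namespace Summit.ValiantsHypothesis.ValiantsHypothesis.Theorems.BarrierLever.TNSRefutation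

/-! ## 1. Bordered determinants are affine-bilinear in the border -/

section Border

variable {ι : Type*} [Fintype ι] [DecidableEq ι]

/-- Linearity of the bordered determinant in its last ROW:
`det [[A₀, y], [x, α]] = α · det A₀ + Σ_c x_c · det [[A₀, y], [e_c, 0]]`. -/
theorem det_border_row (A₀ : Matrix ι ι ℂ) (x y : ι → ℂ) (α : ℂ) :
    (Matrix.fromBlocks A₀ (Matrix.of fun c (_ : Unit) => y c) (Matrix.of fun (_ : Unit) c => x c)
        (Matrix.of fun (_ _ : Unit) => α)).det =
      α * A₀.det + ∑ c, x c * (Matrix.fromBlocks A₀ (Matrix.of fun c (_ : Unit) => y c)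
        (Matrix.of fun (_ : Unit) c' => (Pi.single c (1 : ℂ) : ι → ℂ) c')
        (Matrix.of fun (_ _ : Unit) => (0 : ℂ))).det := by
  set B := Matrix.fromBlocks A₀ (Matrix.of fun c (_ : Unit) => y c)
    (Matrix.of fun (_ : Unit) c => x c) (Matrix.of fun (_ _ : Unit) => α) with hB
  -- the linear map "determinant as a function of the last row"
  set L : (ι ⊕ Unit → ℂ) →ₗ[ℂ] ℂ :=
    ((Matrix.detRowAlternating : (ι ⊕ Unit → ℂ) [⋀^(ι ⊕ Unit)]→ₗ[ℂ] ℂ).toMultilinearMap).toLinearMap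
      B (Sum.inr Unit.unit) with hL
  have hLv : ∀ v : ι ⊕ Unit → ℂ, L v = (B.updateRow (Sum.inr Unit.unit) v).det := by
    intro v
    rw [hL, MultilinearMap.toLinearMap_apply]
    rfl
  -- the last row of `B`
  set v : ι ⊕ Unit → ℂ := B (Sum.inr Unit.unit) with hv
  have hBv : B.updateRow (Sum.inr Unit.unit) v = B := by
    rw [hv, Matrix.updateRow_eq_self]
  have h1 : B.det = L v := by rw [hLv, hBv]
  -- expand `v` in the standard basis
  have hvsum : v = ∑ q, v q • (Pi.single q (1 : ℂ) : ι ⊕ Unit → ℂ) := by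
    ext q
    simp only [Finset.sum_apply, Pi.smul_apply, Pi.single_apply, smul_eq_mul, mul_ite, mul_one,
      mul_zero, Finset.sum_ite_eq, Finset.mem_univ, if_true]
  rw [h1, hvsum, map_sum, Fintype.sum_sum_type, Finset.sum_congr rfl fun q _ => map_smul L _ _,
    Finset.sum_congr rfl fun q _ => map_smul L _ _]
  simp only [Finset.univ_unique, Finset.sum_singleton, smul_eq_mul]
  -- the corner term
  have hcorner : v (Sum.inr Unit.unit) = α := by
    rw [hv, hB]; simp
  have hxc : ∀ c, v (Sum.inl c) = x c := by
    intro c; rw [hv, hB]; simp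
  have hLr : L (Pi.single (Sum.inr Unit.unit) 1) = A₀.det := by
    rw [hLv]
    have : B.updateRow (Sum.inr Unit.unit) (Pi.single (Sum.inr Unit.unit) 1) =
        Matrix.fromBlocks A₀ (Matrix.of fun c (_ : Unit) => y c) 0 1 := by
      ext p q
      rcases p with c | ⟨⟩ <;> rcases q with c' | ⟨⟩
      · simp [hB, Matrix.updateRow_ne]
      · simp [hB, Matrix.updateRow_ne]
      · simp [Matrix.updateRow_self]
      · simp [Matrix.updateRow_self]
    rw [this, Matrix.det_fromBlocks_zero₂₁, Matrix.det_one, mul_one]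
  have hLc : ∀ c, L (Pi.single (Sum.inl c) 1) = (Matrix.fromBlocks A₀ (Matrix.of fun c (_ : Unit) => y c)
        (Matrix.of fun (_ : Unit) c' => (Pi.single c (1 : ℂ) : ι → ℂ) c')
        (Matrix.of fun (_ _ : Unit) => (0 : ℂ))).det := by
    intro c
    rw [hLv]
    congr 1
    ext p q
    rcases p with d | ⟨⟩ <;> rcases q with d' | ⟨⟩
    · simp [hB, Matrix.updateRow_ne]
    · simp [hB, Matrix.updateRow_ne]
    · simp [Matrix.updateRow_self, Pi.single_apply]
    · simp [Matrix.updateRow_self]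
  rw [hcorner, hLr, add_comm]
  congr 1
  exact Finset.sum_congr rfl fun c _ => by rw [hxc, hLc]

omit [Fintype ι] [DecidableEq ι] in
/-- Transpose of a bordered matrix: swaps the two border vectors. -/
theorem border_transpose (A₀ : Matrix ι ι ℂ) (x y : ι → ℂ) (α : ℂ) :
    (Matrix.fromBlocks A₀ (Matrix.of fun c (_ : Unit) => y c) (Matrix.of fun (_ : Unit) c => x c)
        (Matrix.of fun (_ _ : Unit) => α)).transpose =
      Matrix.fromBlocks A₀.transpose (Matrix.of fun c (_ : Unit) => x c)
        (Matrix.of fun (_ : Unit) c => y c) (Matrix.of fun (_ _ : Unit) => α) := by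
  rw [Matrix.fromBlocks_transpose]
  rfl

/-- **The bordered determinant is affine-bilinear in its border**:
`det [[A₀, y], [x, α]] = α · det A₀ + Σ_{c,c'} x_c y_{c'} · E_{c,c'}` with
`E_{c,c'} = det [[A₀, e_{c'}], [e_c, 0]]` depending on `A₀` only. -/
theorem det_border (A₀ : Matrix ι ι ℂ) (x y : ι → ℂ) (α : ℂ) :
    (Matrix.fromBlocks A₀ (Matrix.of fun c (_ : Unit) => y c) (Matrix.of fun (_ : Unit) c => x c)
        (Matrix.of fun (_ _ : Unit) => α)).det =
      α * A₀.det + ∑ c, ∑ c', x c * y c' *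
        (Matrix.fromBlocks A₀ (Matrix.of fun d (_ : Unit) => (Pi.single c' (1 : ℂ) : ι → ℂ) d)
          (Matrix.of fun (_ : Unit) d => (Pi.single c (1 : ℂ) : ι → ℂ) d)
          (Matrix.of fun (_ _ : Unit) => (0 : ℂ))).det := by
  rw [det_border_row]
  congr 1
  refine Finset.sum_congr rfl fun c _ => ?_
  -- linearity in the last column, via the transpose
  have ht : (Matrix.fromBlocks A₀ (Matrix.of fun c (_ : Unit) => y c)
      (Matrix.of fun (_ : Unit) c' => (Pi.single c (1 : ℂ) : ι → ℂ) c')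
      (Matrix.of fun (_ _ : Unit) => (0 : ℂ))).det =
      ∑ c', y c' * (Matrix.fromBlocks A₀
        (Matrix.of fun d (_ : Unit) => (Pi.single c' (1 : ℂ) : ι → ℂ) d)
        (Matrix.of fun (_ : Unit) d => (Pi.single c (1 : ℂ) : ι → ℂ) d)
        (Matrix.of fun (_ _ : Unit) => (0 : ℂ))).det := by
    rw [← Matrix.det_transpose, border_transpose, det_border_row, zero_mul, zero_add]
    refine Finset.sum_congr rfl fun c' _ => ?_
    rw [← Matrix.det_transpose, border_transpose, Matrix.transpose_transpose]
  rw [ht, Finset.mul_sum]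
  exact Finset.sum_congr rfl fun c' _ => by ring

end Border

/-! ## 2. Principal minors on `insert z S` are bordered principal minors on `S` -/

/-- A principal minor depends on the index finset only (transport along an equality of finsets). -/
theorem pm_congr {n : ℕ} (K : Matrix (Fin n) (Fin n) ℂ) {S S' : Finset (Fin n)} (hSS' : S = S') :
    (K.submatrix (Subtype.val : ↥S → Fin n) (Subtype.val : ↥S → Fin n)).det =
      (K.submatrix (Subtype.val : ↥S' → Fin n) (Subtype.val : ↥S' → Fin n)).det := by
  subst hSS'
  rfl

/-- The principal minor on `insert z S` (`z ∉ S`) is the determinant of the principal minor on `S`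
bordered by the `z`-th row and column. -/
theorem pm_insert {n : ℕ} (K : Matrix (Fin n) (Fin n) ℂ) (S : Finset (Fin n)) (z : Fin n)
    (hz : z ∉ S) :
    (K.submatrix (Subtype.val : ↥(insert z S) → Fin n) (Subtype.val : ↥(insert z S) → Fin n)).det =
      (Matrix.fromBlocks (K.submatrix (Subtype.val : ↥S → Fin n) (Subtype.val : ↥S → Fin n))
        (Matrix.of fun (c : ↥S) (_ : Unit) => K c.1 z) (Matrix.of fun (_ : Unit) (c : ↥S) => K z c.1)
        (Matrix.of fun (_ _ : Unit) => K z z)).det := by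
  let e : ↥S ⊕ Unit ≃ ↥(insert z S) :=
    ((Finset.subtypeInsertEquivOption hz).trans (Equiv.optionEquivSumPUnit.{0} ↥S)).symm
  have he1 : ∀ c : ↥S, ((e (Sum.inl c) : ↥(insert z S)) : Fin n) = c.1 := by
    intro c
    simp [e, Finset.subtypeInsertEquivOption, Equiv.optionEquivSumPUnit]
  have he2 : ((e (Sum.inr Unit.unit) : ↥(insert z S)) : Fin n) = z := by
    simp [e, Finset.subtypeInsertEquivOption, Equiv.optionEquivSumPUnit]
  rw [← Matrix.det_submatrix_equiv_self e]
  congr 1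
  ext p q
  rcases p with c | ⟨⟩ <;> rcases q with c' | ⟨⟩ <;>
    simp only [Matrix.submatrix_apply, Matrix.fromBlocks_apply₁₁, Matrix.fromBlocks_apply₁₂,
      Matrix.fromBlocks_apply₂₁, Matrix.fromBlocks_apply₂₂, Matrix.of_apply, he1, he2]

/-! ## 3. Layouts with empty/singleton rows against a small column block are dead for EVERY `K` -/

/-- If the border row is identically zero, the bordered determinant (corner `0`) vanishes. -/
theorem det_border_zero_row {ι : Type*} [Fintype ι] [DecidableEq ι] (A₀ : Matrix ι ι ℂ)
    (y : ι → ℂ) :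
    (Matrix.fromBlocks A₀ (Matrix.of fun c (_ : Unit) => y c) (Matrix.of fun (_ : Unit) (_ : ι) => (0 : ℂ))
        (Matrix.of fun (_ _ : Unit) => (0 : ℂ))).det = 0 := by
  have h0 : (Matrix.of fun (_ : Unit) (_ : ι) => (0 : ℂ)) = 0 := rfl
  have h0' : (Matrix.of fun (_ _ : Unit) => (0 : ℂ)) = 0 := rfl
  rw [h0, h0', Matrix.det_fromBlocks_zero₂₁, Matrix.det_zero, mul_zero]

/-- If the border column is identically zero, the bordered determinant (corner `0`) vanishes. -/
theorem det_border_zero_col {ι : Type*} [Fintype ι] [DecidableEq ι] (A₀ : Matrix ι ι ℂ)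
    (x : ι → ℂ) :
    (Matrix.fromBlocks A₀ (Matrix.of fun (_ : ι) (_ : Unit) => (0 : ℂ)) (Matrix.of fun (_ : Unit) c => x c)
        (Matrix.of fun (_ _ : Unit) => (0 : ℂ))).det = 0 := by
  have h0 : (Matrix.of fun (_ : ι) (_ : Unit) => (0 : ℂ)) = 0 := rfl
  have h0' : (Matrix.of fun (_ _ : Unit) => (0 : ℂ)) = 0 := rfl
  rw [h0, h0', Matrix.det_fromBlocks_zero₁₂, Matrix.det_zero, mul_zero]

/-- **The capacity bound.** Let `T ⊆ Fin h` and let `(u, w)` be a layout all of whose rows are empty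
or singletons and all of whose columns lie inside `T`. If `r > |T|² + 1` then the principal-minor
layout matrix `(det K[u_i ⊔ w̄_j])_{i,j}` is SINGULAR for EVERY `K`: by the bordered expansion each
row `(det K[{a} ⊔ w̄_j])_j = K_{aa}·(det K[w̄_j])_j + Σ_{c,c' ∈ T} K_{a c̄} K_{c̄' a}·(E^j_{c,c'})_j`
lies in the span of the `1 + |T|²` vectors `(det K[w̄_j])_j`, `(E^j_{c,c'})_j`, which depend on
the block `K[T̄, T̄]` alone. -/
theorem tns_det_eq_zero_of_singleton_rows {h r : ℕ} (K : Matrix (Fin (h + h)) (Fin (h + h)) ℂ)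
    (T : Finset (Fin h)) (u w : Fin r → Finset (Fin h))
    (hu : ∀ i, u i = ∅ ∨ ∃ a, u i = {a}) (hw : ∀ j, w j ⊆ T) (hr : T.card * T.card + 1 < r) :
    (Matrix.of fun i j : Fin r => (K.submatrix
      (Subtype.val : ↥((u i).map (Fin.castAddEmb h) ∪ (w j).map (Fin.natAddEmb h)) → Fin (h + h))
      (Subtype.val : ↥((u i).map (Fin.castAddEmb h) ∪ (w j).map (Fin.natAddEmb h)) →
        Fin (h + h))).det).det = 0 := by
  classical
  -- abbreviations
  set M := (Matrix.of fun i j : Fin r => (K.submatrix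
      (Subtype.val : ↥((u i).map (Fin.castAddEmb h) ∪ (w j).map (Fin.natAddEmb h)) → Fin (h + h))
      (Subtype.val : ↥((u i).map (Fin.castAddEmb h) ∪ (w j).map (Fin.natAddEmb h)) →
        Fin (h + h))).det) with hM
  -- the column-side data: W̄_j, D_j = det K[W̄_j], E^j(z, z')
  let Wb : Fin r → Finset (Fin (h + h)) := fun j => (w j).map (Fin.natAddEmb h)
  let D : Fin r → ℂ := fun j =>
    (K.submatrix (Subtype.val : ↥(Wb j) → Fin (h + h)) (Subtype.val : ↥(Wb j) → Fin (h + h))).det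
  let E : Fin (h + h) → Fin (h + h) → Fin r → ℂ := fun z z' j =>
    (Matrix.fromBlocks (K.submatrix (Subtype.val : ↥(Wb j) → Fin (h + h))
        (Subtype.val : ↥(Wb j) → Fin (h + h)))
      (Matrix.of fun (d : ↥(Wb j)) (_ : Unit) => if d.1 = z' then (1 : ℂ) else 0)
      (Matrix.of fun (_ : Unit) (d : ↥(Wb j)) => if d.1 = z then (1 : ℂ) else 0)
      (Matrix.of fun (_ _ : Unit) => (0 : ℂ))).det
  let g : Option (↥T × ↥T) → (Fin r → ℂ) := fun o =>
    match o with
    | none => D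
    | some (c, c') => E (Fin.natAdd h c.1) (Fin.natAdd h c'.1)
  -- every row of `M` lies in the span of the `1 + |T|²` vectors `g`
  have hrow : ∀ i, M i ∈ Submodule.span ℂ (Set.range g) := by
    intro i
    rcases hu i with h0 | ⟨a, ha⟩
    · -- empty row: `M i = D`
      have hMi : M i = D := by
        funext j
        simp only [hM, Matrix.of_apply]
        exact pm_congr K (by rw [h0, Finset.map_empty, Finset.empty_union])
      rw [hMi]
      exact Submodule.subset_span ⟨none, rfl⟩
    · -- singleton row `{a}`: bordered expansion
      set â : Fin (h + h) := Fin.castAdd h a with hâ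
      have hnot : ∀ j, â ∉ Wb j := by
        intro j hmem
        obtain ⟨c, -, hc⟩ := Finset.mem_map.1 hmem
        have h1 := congrArg Fin.val hc
        simp only [Fin.natAddEmb_apply, Fin.val_natAdd, hâ, Fin.val_castAdd] at h1
        have := a.isLt
        omega
      have hMi : ∀ j, M i j = K â â * D j +
          ∑ d : ↥(Wb j), ∑ d' : ↥(Wb j), K â d.1 * K d'.1 â *
            (Matrix.fromBlocks (K.submatrix (Subtype.val : ↥(Wb j) → Fin (h + h))
                (Subtype.val : ↥(Wb j) → Fin (h + h)))
              (Matrix.of fun (e : ↥(Wb j)) (_ : Unit) => (Pi.single d' (1 : ℂ) : ↥(Wb j) → ℂ) e)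
              (Matrix.of fun (_ : Unit) (e : ↥(Wb j)) => (Pi.single d (1 : ℂ) : ↥(Wb j) → ℂ) e)
              (Matrix.of fun (_ _ : Unit) => (0 : ℂ))).det := by
        intro j
        simp only [hM, Matrix.of_apply]
        rw [pm_congr K (S' := insert â (Wb j)) (by
          rw [ha, Finset.map_singleton, Fin.castAddEmb_apply, ← Finset.insert_eq]),
          pm_insert K (Wb j) â (hnot j), det_border]
      -- rewrite the double sum over `↥(Wb j)` as a double sum over `↥T`
      have hsum : ∀ j, (∑ d : ↥(Wb j), ∑ d' : ↥(Wb j), K â d.1 * K d'.1 â *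
            (Matrix.fromBlocks (K.submatrix (Subtype.val : ↥(Wb j) → Fin (h + h))
                (Subtype.val : ↥(Wb j) → Fin (h + h)))
              (Matrix.of fun (e : ↥(Wb j)) (_ : Unit) => (Pi.single d' (1 : ℂ) : ↥(Wb j) → ℂ) e)
              (Matrix.of fun (_ : Unit) (e : ↥(Wb j)) => (Pi.single d (1 : ℂ) : ↥(Wb j) → ℂ) e)
              (Matrix.of fun (_ _ : Unit) => (0 : ℂ))).det) =
          ∑ c : ↥T, ∑ c' : ↥T, K â (Fin.natAdd h c.1) * K (Fin.natAdd h c'.1) â *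
            E (Fin.natAdd h c.1) (Fin.natAdd h c'.1) j := by
        intro j
        -- the summand as a function of ambient indices
        let F : Fin (h + h) → Fin (h + h) → ℂ := fun z z' => K â z * K z' â * E z z' j
        have hF0 : ∀ z z', z ∉ Wb j → F z z' = 0 := by
          intro z z' hz
          have hrow0 : (Matrix.of fun (_ : Unit) (d : ↥(Wb j)) => if d.1 = z then (1 : ℂ) else 0) =
              Matrix.of fun (_ : Unit) (_ : ↥(Wb j)) => (0 : ℂ) := by
            ext _ d
            simp only [Matrix.of_apply]
            rw [if_neg (fun hd : (d : Fin (h + h)) = z => hz (hd ▸ d.2))]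
          show K â z * K z' â * E z z' j = 0
          simp only [E]
          rw [hrow0, det_border_zero_row, mul_zero]
        have hF0' : ∀ z z', z' ∉ Wb j → F z z' = 0 := by
          intro z z' hz'
          have hcol0 : (Matrix.of fun (d : ↥(Wb j)) (_ : Unit) => if d.1 = z' then (1 : ℂ) else 0) =
              Matrix.of fun (_ : ↥(Wb j)) (_ : Unit) => (0 : ℂ) := by
            ext d _
            simp only [Matrix.of_apply]
            rw [if_neg (fun hd : (d : Fin (h + h)) = z' => hz' (hd ▸ d.2))]
          show K â z * K z' â * E z z' j = 0
          simp only [E]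
          rw [hcol0, det_border_zero_col, mul_zero]
        -- LHS = Σ_{z ∈ Wb j} Σ_{z' ∈ Wb j} F z z'
        have hL : (∑ d : ↥(Wb j), ∑ d' : ↥(Wb j), K â d.1 * K d'.1 â *
            (Matrix.fromBlocks (K.submatrix (Subtype.val : ↥(Wb j) → Fin (h + h))
                (Subtype.val : ↥(Wb j) → Fin (h + h)))
              (Matrix.of fun (e : ↥(Wb j)) (_ : Unit) => (Pi.single d' (1 : ℂ) : ↥(Wb j) → ℂ) e)
              (Matrix.of fun (_ : Unit) (e : ↥(Wb j)) => (Pi.single d (1 : ℂ) : ↥(Wb j) → ℂ) e)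
              (Matrix.of fun (_ _ : Unit) => (0 : ℂ))).det) =
            ∑ z ∈ Wb j, ∑ z' ∈ Wb j, F z z' := by
          rw [← Finset.sum_coe_sort (Wb j)]
          refine Finset.sum_congr rfl fun d _ => ?_
          rw [← Finset.sum_coe_sort (Wb j)]
          refine Finset.sum_congr rfl fun d' _ => ?_
          show _ = K â d.1 * K d'.1 â * E d.1 d'.1 j
          simp only [E]
          congr 3 <;> ext p q <;> simp only [Matrix.of_apply, Pi.single_apply, Subtype.ext_iff]
        -- RHS = Σ_{c ∈ T} Σ_{c' ∈ T} F (natAdd c) (natAdd c') = Σ_{z ∈ T̄} Σ_{z' ∈ T̄} F z z'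
        have hR : (∑ c : ↥T, ∑ c' : ↥T, K â (Fin.natAdd h c.1) * K (Fin.natAdd h c'.1) â *
            E (Fin.natAdd h c.1) (Fin.natAdd h c'.1) j) =
            ∑ z ∈ T.map (Fin.natAddEmb h), ∑ z' ∈ T.map (Fin.natAddEmb h), F z z' := by
          rw [Finset.sum_map, ← Finset.sum_coe_sort T]
          refine Finset.sum_congr rfl fun c _ => ?_
          rw [Finset.sum_map, ← Finset.sum_coe_sort T]
          rfl
        rw [hL, hR]
        -- pass from `Wb j ⊆ T̄` to `T̄` using the vanishing of `F` off `Wb j`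
        have hsub : Wb j ⊆ T.map (Fin.natAddEmb h) := Finset.map_subset_map.2 (hw j)
        rw [Finset.sum_subset hsub (fun z _ hz => Finset.sum_eq_zero fun z' _ => hF0 z z' hz)]
        refine Finset.sum_congr rfl fun z _ => ?_
        exact Finset.sum_subset hsub (fun z' _ hz' => hF0' z z' hz')
      have hMi' : M i = K â â • D + ∑ c : ↥T, ∑ c' : ↥T,
          (K â (Fin.natAdd h c.1) * K (Fin.natAdd h c'.1) â) • E (Fin.natAdd h c.1) (Fin.natAdd h c'.1) := by
        funext j
        rw [hMi j, hsum j]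
        simp only [Pi.add_apply, Pi.smul_apply, Finset.sum_apply, smul_eq_mul]
      rw [hMi']
      refine Submodule.add_mem _ (Submodule.smul_mem _ _ (Submodule.subset_span ⟨none, rfl⟩)) ?_
      refine Submodule.sum_mem _ fun c _ => Submodule.sum_mem _ fun c' _ => ?_
      exact Submodule.smul_mem _ _ (Submodule.subset_span ⟨some (c, c'), rfl⟩)
  -- the span of the rows has dimension ≤ 1 + |T|² < r, so the rows are dependent
  by_contra hdet
  have hunit : IsUnit M := (Matrix.isUnit_iff_isUnit_det M).2 (isUnit_iff_ne_zero.2 hdet)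
  have hli : LinearIndependent ℂ M.row := Matrix.linearIndependent_rows_iff_isUnit.2 hunit
  have hcard : Fintype.card (Fin r) = (Set.range M.row).finrank ℂ :=
    linearIndependent_iff_card_eq_finrank_span.1 hli
  have hle : Submodule.span ℂ (Set.range M.row) ≤ Submodule.span ℂ (Set.range g) :=
    Submodule.span_le.2 (by rintro _ ⟨i, rfl⟩; exact hrow i)
  have h1 : (Set.range M.row).finrank ℂ ≤ (Set.range g).finrank ℂ := Submodule.finrank_mono hle
  have h2 : (Set.range g).finrank ℂ ≤ Fintype.card (Option (↥T × ↥T)) := finrank_range_le_card g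
  rw [Fintype.card_option, Fintype.card_prod, Fintype.card_coe] at h2
  rw [Fintype.card_fin] at hcard
  omega

end Summit.ValiantsHypothesis.ValiantsHypothesis.Theorems.BarrierLever.TNSRefutation
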